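import Summits.QuantumFields.YangMills.Theorems.UnitScaleTiltProp7FibreLevelMass
import Summits.QuantumFields.YangMills.Theorems.UnitScaleTiltProp7FibreLevelMassInduction
import Summits.QuantumFields.YangMills.Theorems.UnitScaleTiltProp7FibreLevelMassT3Letters
import Summits.QuantumFields.YangMills.Theorems.UnitScaleTiltProp7LineIterVsEngineOfTower
import HarnessLib

/-!
# Route `UnitScaleTilt`, crux K1 «MinimiserStabilityRegPr» (stmt-QuantumFields-19200), route-R [RP] curved, row (n3) N3b, file F4b —
# THE `ℓ²` MASS OF THE RATIO TOWER AT EVERY LEVEL (d = 3, `SU(2)`), EXPLICIT: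
# `Σ_b‖Y_l(b)‖² ≤ 7·L^{−l}·Σ‖Y‖² + L^{l}·(144·B² + 8·10⁵L⁴θ²ℓ⁻²Σ‖Y‖²)`, `B² = 200L⁴(CURL + DIV) + 4·10⁹L⁹εℓ⁻²Σ‖Y‖²`, for every `l ≤ K − n`

Cell `ym3-torus`, D-0154 (3c) extra-width seat `ym-routeR-w6` (gen 3); the "T³ letters" half of LEAD ★p1 g14's NAMED file F4 (2026-08-28 15:11Z, «(c1′) … from the
level-mass theorems (real bookkeeping + the T3 letters)»); sequel of ✓ `…Prop7FibreLevelMassT3` (★routeR-w3 g2).  THEOREMS ONLY (0 `def`, 0 `sorry`);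
`--supports stmt-QuantumFields-19200`, count-neutral.  YM₃ on T³ is a ladder rung (R3), not the Clay problem; nothing here claims the stub, the crux, d = 4 or the mass gap.

THE POINT.  ✓ `Prop7FibreLevelMassT3.sum_normSq_trueLinIter_le_explicit_T3` runs the scalar induction ✓ `Prop7FibreLevelMassInduction.levelMass_induction` over the
structure rows ✓ `Prop7FibreLevelMass.sqrt_sum_normSq_levelRatio_le` (every level) and ✓ `…T3Letters.sum_normSq_covIterLambda_le_level` ((R-B) at every level), and then
USES ONLY ITS SECOND CONJUNCT (the top-level source budget on the fibre).  Its FIRST conjunct — `ρˡ·‖Y_l‖_{ℓ²} ≤ (3/2)ρ^{2l}‖Y‖_{ℓ²} + 2(2√d·B + θ·(3/2)·K₀·((3/2)‖Y‖_{ℓ²}ρ^{2k+1}/(1−ρ²)))`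
for EVERY `l ≤ k = K − n` — is exactly the per-level `ℓ²` mass the conserved-current joint row needs (✓ F2 `…FibreLogRatioGaugedL1` damps level-`l` sources by `ρ₁^{k−1−l}`,
F3 `…LogRemainderMass` bounds them by `C·Σ_b‖Y_l b‖²`, ✓ F4 `…JointRowOfLevelMasses` does the power counting from `M_l ≤ A·L^{−l} + B·L^{l}`).  Here it is exported, squared
(`ρ²L = 1` ⇒ `‖Y_l‖² ≤ Lˡ·W_l²`) and put in numerals (`(p+q+r)² ≤ 3(p²+q²+r²)`, `D² = 12`, `K₀ ≤ 132L²`, `L/(L−1)² ≤ 3/4`).  NO fibre hypothesis: the per-level masses hold for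
any pair `(U₀, W)` under the (14)-type plaquette bound of `U₀` and the per-level two-block sups with their (B6)-shape.

WHAT IS PROVED (ns `…Theorems.Prop7FibreLevelMassPerLevelT3`).
* §1 `perLevel_endgame` — the numerals (pure reals): `Lˡ·((3/2)ρ^{2l}x₀ + 2(D√B + θ(3/2)K₀((3/2)x₀ρ^{2k+1}/(1−ρ²))))² ≤ 7x₀²L^{−l} + (144B + 8·10⁵L⁴θ²L^{−2k}x₀²)·Lˡ`.
* §2 ★★ `sum_normSq_levelRatio_le_explicit_T3` — the title, with the binders of ✓ `sum_normSq_trueLinIter_le_explicit_T3` VERBATIM minus `hfib`.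
* §3 ★★ `sum_normSq_levelRatio_le_LOnly_T3` — the same with `ε, θ` absorbed (`10⁶L⁵ε ≤ 1`, `10³θL ≤ 1`) and the four recursion families DISCHARGED by their existence theorems:
  `Σ_b‖Y_l b‖² ≤ 7·Σ‖Y‖²·(Lˡ)⁻¹ + (28800L⁴·(CURL + DIV) + 600000L⁴·(ℓ²)⁻¹·Σ‖Y‖²)·Lˡ` — the `hM` shape of ✓ `Prop7JointRowOfLevelMasses.jointRow_currency`
  (`c_A = 7`, `c_B = 28800L⁴`, `c_B′·ε ↦ 600000L⁴`, `KD = CURL + DIV`, `M₀ = Σ‖Y‖²`).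
HONEST SCOPE.  A knit of landed theorems plus numerals; constants generous, k- and volume-independent.  Displayed (named suppliers, as in the parent file): the plaquette bound of
`U₀`, the recursion families (zero content), the per-level two-block sups `μ_j` with their (B6)-shape bound and `θ`.

References: T. Bałaban, CMP 98 (1985) 17–51 [Balaban1985Averaging] (Prop. 3 (122)–(126) p.36); CMP 95 (1984) 17–40 [Balaban1984PropagatorsI] ((1.18)–(1.20) pp.19–20);
CMP 99 (1985) 389–434 [Balaban1985BackgroundPropagators] (Thm 3.11 p.416); CMP 102 (1985) 277–309 [Balaban1985Variational] ((14)–(15) p.280, Prop. 7 p.299).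
-/

set_option autoImplicit false

noncomputable section

open scoped BigOperators Matrix.Norms.L2Operator Matrix

namespace Summit.QuantumFields.YangMills.Theorems.Prop7FibreLevelMassPerLevelT3

open Literature.MathematicalPhysics.QuantumFieldTheory.Balaban1983to89
open Literature.MathematicalPhysics.QuantumFieldTheory.Balaban1983to89.T3ContinuumYM3Torus
open Finset T4Continuum T4ReflectionCone BlockAveraging AveragingRT ExpMeanLog BlockAveragingEMLLinearised BlockAveragingEMLLinearisedBackground
  BlockAveragingEMLProp2 B1RG242Torus
open B9Eq39Adjoint (curl divB)
open B10Eq27TorusAxialLog (holT unitsField toUField)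
open B9TorusCalculus (torusT)
open Summit.QuantumFields.YangMills.Theorems.Prop7CurvedLandauKnitT3 (smallness_T3 three_le_L)
open Summit.QuantumFields.YangMills.Theorems.Prop7CurvedLandauRowE (loop_size_geom size_numerals)
open Summit.QuantumFields.YangMills.Theorems.Prop7CovIterLambdaBound (tower_plaq_lt plaqSmall_of_le_of_lt)
open Summit.QuantumFields.YangMills.Theorems.Prop7CurvedLandauRowA (exists_trueLinIter_family exists_reduced_family exists_coarseGauge_family)
open Summit.QuantumFields.YangMills.Theorems.Prop7LineIterVsEngineOfTower (exists_pureLine_family)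
open Summit.QuantumFields.YangMills.Theorems.Prop7FibreLevelMass (sqrt_sum_normSq_levelRatio_le)
open Summit.QuantumFields.YangMills.Theorems.Prop7FibreLevelMassInduction (levelMass_induction)
open Summit.QuantumFields.YangMills.Theorems.Prop7FibreLevelMassT3Letters (rho_facts two_sqrt_d_facts K0_nonneg K0_le theta_smallness coeff_of_B6
  level_exp_le rho_pow_mul_sqrt_le sq_le_of_rho_pow_mul_le sum_normSq_covIterLambda_le_level)

/-! ## §1 The numerals (pure reals) -/

/-- THE PER-LEVEL NUMERIC END-GAME (pure reals): with `ρ²L = 1`, `D² = 12`, `0 ≤ K₀ ≤ 132L²`, `L ≥ 3`, `B ≥ 0`,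
`Lˡ·((3/2)ρ^{2l}x₀ + 2(D√B + θ(3/2)K₀((3/2)x₀ρ^{2k+1}/(1−ρ²))))² ≤ 7·x₀²·(Lˡ)⁻¹ + (144·B + 8·10⁵·L⁴·θ²·(L^k)⁻²·x₀²)·Lˡ`. [folklore] -/
theorem perLevel_endgame {L ρ D K₀ B : ℝ} (θ x₀ : ℝ) (l k : ℕ) (hL : 3 ≤ L) (hρL : ρ ^ 2 * L = 1) (hD : D ^ 2 = 12)
    (hK0 : 0 ≤ K₀) (hK : K₀ ≤ 132 * L ^ 2) (hB : 0 ≤ B) :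
    L ^ l * (3 / 2 * ρ ^ (2 * l) * x₀ + 2 * (D * Real.sqrt B + θ * (3 / 2) * K₀ * (3 / 2 * x₀ * ρ ^ (2 * k + 1) / (1 - ρ ^ 2)))) ^ 2
      ≤ 7 * x₀ ^ 2 * (L ^ l)⁻¹ + (144 * B + 800000 * L ^ 4 * θ ^ 2 * ((L ^ k) ^ 2)⁻¹ * x₀ ^ 2) * L ^ l := by
  have hL0 : 0 < L := by linarith
  have hLl : 0 < L ^ l := pow_pos hL0 l
  have hLk : 0 < L ^ k := pow_pos hL0 k
  have hLne : L ≠ 0 := hL0.ne'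
  have hL1ne : L - 1 ≠ 0 := (show (0:ℝ) < L - 1 by linarith).ne'
  have hLkne : L ^ k ≠ 0 := hLk.ne'
  have hρ2 : ρ ^ 2 = L⁻¹ := eq_inv_of_mul_eq_one_left hρL
  have hs : 1 - ρ ^ 2 = (L - 1) / L := by rw [hρ2]; field_simp
  -- `L^l·(ρ^{2l})² = (L^l)⁻¹`
  have hidl : L ^ l * (ρ ^ (2 * l)) ^ 2 * L ^ l = 1 := by
    have : L ^ l * (ρ ^ (2 * l)) ^ 2 * L ^ l = (ρ ^ 2 * L) ^ (2 * l) := by ring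
    rw [this, hρL, one_pow]
  have hul : L ^ l * (ρ ^ (2 * l)) ^ 2 = (L ^ l)⁻¹ := eq_inv_of_mul_eq_one_left hidl
  -- `(ρ^{2k+1})² = ((L^k)²·L)⁻¹`
  have hidk : (ρ ^ (2 * k + 1)) ^ 2 * ((L ^ k) ^ 2 * L) = 1 := by
    have : (ρ ^ (2 * k + 1)) ^ 2 * ((L ^ k) ^ 2 * L) = (ρ ^ 2 * L) ^ (2 * k + 1) := by ring
    rw [this, hρL, one_pow]
  have huk : (ρ ^ (2 * k + 1)) ^ 2 = ((L ^ k) ^ 2 * L)⁻¹ := eq_inv_of_mul_eq_one_left hidk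
  -- the square of the three-term sum
  have hsq : (3 / 2 * ρ ^ (2 * l) * x₀ + 2 * (D * Real.sqrt B + θ * (3 / 2) * K₀ * (3 / 2 * x₀ * ρ ^ (2 * k + 1) / (1 - ρ ^ 2)))) ^ 2
      ≤ 3 * ((3 / 2 * ρ ^ (2 * l) * x₀) ^ 2 + (2 * (D * Real.sqrt B)) ^ 2 + (2 * (θ * (3 / 2) * K₀ * (3 / 2 * x₀ * ρ ^ (2 * k + 1) / (1 - ρ ^ 2)))) ^ 2) := by
    have e : (3 / 2 * ρ ^ (2 * l) * x₀ + 2 * (D * Real.sqrt B + θ * (3 / 2) * K₀ * (3 / 2 * x₀ * ρ ^ (2 * k + 1) / (1 - ρ ^ 2)))) ^ 2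
        = 3 * ((3 / 2 * ρ ^ (2 * l) * x₀) ^ 2 + (2 * (D * Real.sqrt B)) ^ 2 + (2 * (θ * (3 / 2) * K₀ * (3 / 2 * x₀ * ρ ^ (2 * k + 1) / (1 - ρ ^ 2)))) ^ 2)
          - (3 / 2 * ρ ^ (2 * l) * x₀ - 2 * (D * Real.sqrt B)) ^ 2
          - (3 / 2 * ρ ^ (2 * l) * x₀ - 2 * (θ * (3 / 2) * K₀ * (3 / 2 * x₀ * ρ ^ (2 * k + 1) / (1 - ρ ^ 2)))) ^ 2
          - (2 * (D * Real.sqrt B) - 2 * (θ * (3 / 2) * K₀ * (3 / 2 * x₀ * ρ ^ (2 * k + 1) / (1 - ρ ^ 2)))) ^ 2 := by ring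
    rw [e]
    linarith only [sq_nonneg (3 / 2 * ρ ^ (2 * l) * x₀ - 2 * (D * Real.sqrt B)), sq_nonneg (3 / 2 * ρ ^ (2 * l) * x₀ - 2 * (θ * (3 / 2) * K₀ * (3 / 2 * x₀ * ρ ^ (2 * k + 1) / (1 - ρ ^ 2)))),
      sq_nonneg (2 * (D * Real.sqrt B) - 2 * (θ * (3 / 2) * K₀ * (3 / 2 * x₀ * ρ ^ (2 * k + 1) / (1 - ρ ^ 2))))]
  -- the three pieces in closed form
  have hP : L ^ l * (3 / 2 * ρ ^ (2 * l) * x₀) ^ 2 = 9 / 4 * x₀ ^ 2 * (L ^ l)⁻¹ := by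
    rw [show L ^ l * (3 / 2 * ρ ^ (2 * l) * x₀) ^ 2 = 9 / 4 * x₀ ^ 2 * (L ^ l * (ρ ^ (2 * l)) ^ 2) by ring, hul]
  have hQ : (2 * (D * Real.sqrt B)) ^ 2 = 48 * B := by
    rw [show (2 * (D * Real.sqrt B)) ^ 2 = 4 * D ^ 2 * Real.sqrt B ^ 2 by ring, hD, Real.sq_sqrt hB]; ring
  have hR : (2 * (θ * (3 / 2) * K₀ * (3 / 2 * x₀ * ρ ^ (2 * k + 1) / (1 - ρ ^ 2)))) ^ 2
      = 81 / 4 * (K₀ ^ 2 * (L / (L - 1) ^ 2) * (θ ^ 2 * x₀ ^ 2 * ((L ^ k) ^ 2)⁻¹)) := by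
    calc (2 * (θ * (3 / 2) * K₀ * (3 / 2 * x₀ * ρ ^ (2 * k + 1) / (1 - ρ ^ 2)))) ^ 2
        = 81 / 4 * θ ^ 2 * K₀ ^ 2 * x₀ ^ 2 * (ρ ^ (2 * k + 1)) ^ 2 * (1 / (1 - ρ ^ 2)) ^ 2 := by ring
      _ = 81 / 4 * θ ^ 2 * K₀ ^ 2 * x₀ ^ 2 * ((L ^ k) ^ 2 * L)⁻¹ * (1 / ((L - 1) / L)) ^ 2 := by rw [huk, hs]
      _ = 81 / 4 * (K₀ ^ 2 * (L / (L - 1) ^ 2) * (θ ^ 2 * x₀ ^ 2 * ((L ^ k) ^ 2)⁻¹)) := by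
          field_simp
  have hK2 : K₀ ^ 2 ≤ 17424 * L ^ 4 := by nlinarith [mul_le_mul hK hK hK0 (by positivity), hK0]
  have hfrac : L / (L - 1) ^ 2 ≤ 3 / 4 := by
    have hpos : (0 : ℝ) < (L - 1) ^ 2 := by positivity
    rw [div_le_iff₀ hpos]
    nlinarith [mul_nonneg (sub_nonneg.2 hL) (by linarith : (0 : ℝ) ≤ 3 * L - 1)]
  have hfrac0 : 0 ≤ L / (L - 1) ^ 2 := by positivity
  have h0 : 0 ≤ θ ^ 2 * x₀ ^ 2 * ((L ^ k) ^ 2)⁻¹ := by positivity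
  have hprod : K₀ ^ 2 * (L / (L - 1) ^ 2) ≤ 17424 * L ^ 4 * (3 / 4) := mul_le_mul hK2 hfrac hfrac0 (by positivity)
  have hA : K₀ ^ 2 * (L / (L - 1) ^ 2) * (θ ^ 2 * x₀ ^ 2 * ((L ^ k) ^ 2)⁻¹) ≤ 13068 * L ^ 4 * (θ ^ 2 * x₀ ^ 2 * ((L ^ k) ^ 2)⁻¹) := by
    have h := mul_le_mul_of_nonneg_right hprod h0
    linarith
  have hx0 : 0 ≤ x₀ ^ 2 * (L ^ l)⁻¹ := by positivity
  have hM0 : 0 ≤ L ^ 4 * (θ ^ 2 * x₀ ^ 2 * ((L ^ k) ^ 2)⁻¹) * L ^ l := by positivity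
  calc L ^ l * (3 / 2 * ρ ^ (2 * l) * x₀ + 2 * (D * Real.sqrt B + θ * (3 / 2) * K₀ * (3 / 2 * x₀ * ρ ^ (2 * k + 1) / (1 - ρ ^ 2)))) ^ 2
      ≤ L ^ l * (3 * ((3 / 2 * ρ ^ (2 * l) * x₀) ^ 2 + (2 * (D * Real.sqrt B)) ^ 2 + (2 * (θ * (3 / 2) * K₀ * (3 / 2 * x₀ * ρ ^ (2 * k + 1) / (1 - ρ ^ 2)))) ^ 2)) :=
        mul_le_mul_of_nonneg_left hsq hLl.le
    _ = 3 * (L ^ l * (3 / 2 * ρ ^ (2 * l) * x₀) ^ 2) + 3 * (2 * (D * Real.sqrt B)) ^ 2 * L ^ l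
          + 3 * (2 * (θ * (3 / 2) * K₀ * (3 / 2 * x₀ * ρ ^ (2 * k + 1) / (1 - ρ ^ 2)))) ^ 2 * L ^ l := by ring
    _ = 27 / 4 * x₀ ^ 2 * (L ^ l)⁻¹ + 144 * B * L ^ l
          + 243 / 4 * (K₀ ^ 2 * (L / (L - 1) ^ 2) * (θ ^ 2 * x₀ ^ 2 * ((L ^ k) ^ 2)⁻¹)) * L ^ l := by rw [hP, hQ, hR]; ring
    _ ≤ 27 / 4 * x₀ ^ 2 * (L ^ l)⁻¹ + 144 * B * L ^ l + 243 / 4 * (13068 * L ^ 4 * (θ ^ 2 * x₀ ^ 2 * ((L ^ k) ^ 2)⁻¹)) * L ^ l := by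
        have := mul_le_mul_of_nonneg_right (mul_le_mul_of_nonneg_left hA (by norm_num : (0:ℝ) ≤ 243 / 4)) hLl.le
        linarith
    _ ≤ 7 * x₀ ^ 2 * (L ^ l)⁻¹ + (144 * B + 800000 * L ^ 4 * θ ^ 2 * ((L ^ k) ^ 2)⁻¹ * x₀ ^ 2) * L ^ l := by
        have e : (144 * B + 800000 * L ^ 4 * θ ^ 2 * ((L ^ k) ^ 2)⁻¹ * x₀ ^ 2) * L ^ l
            = 144 * B * L ^ l + 800000 * (L ^ 4 * (θ ^ 2 * x₀ ^ 2 * ((L ^ k) ^ 2)⁻¹) * L ^ l) := by ring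
        rw [e]
        linarith only [hx0, hM0]

/-! ## §2 ★★ The `ℓ²` mass of the ratio tower at every level, explicit -/

set_option maxHeartbeats 400000 in
/-- ★★ **THE `ℓ²` MASS OF THE LEVEL-`l` RATIO FIELD, EXPLICIT (d = 3, `SU(2)`), FOR EVERY `l ≤ K − n`.**  `U₀, W` on the finest torus of run `K`;
`dist1(U₀(∂p)) ≤ εℓ⁻²` (`ℓ = L^{K−n}`, `0 < ε`, `10⁶L⁵ε ≤ 1`); `Q, G, S, Λ` the recursion families of record at `Y := pertVar U₀ W = WU₀* − 1` (displayed, zero content);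
per-level bounds `μ_j` of the two-block masses `(d+2)L·Σ_{b∈N(c)}‖Y_j(b)‖` (`0 ≤ μ_j`, `72μ_j ≤ 1`, `3μ_j + 1/24 < δ₂`) with the (B6)-shape `7800·L³·ℓ·μ_j ≤ θ·Lʲ` and
`1000·θ·L ≤ 1`; NO fibre hypothesis.  THEN for every `l ≤ K − n`, with `Y_l := pertVar Ū₀^{(l)} W̄^{(l)}`,
`Σ_b‖Y_l(b)‖² ≤ 7·Σ‖Y‖²·(Lˡ)⁻¹ + (144·(200L⁴(Σ‖curl_{U₀}Y‖²_HS + Σ‖D^*_{U₀}Y‖²_HS) + 4·10⁹L⁹εℓ⁻²Σ‖Y‖²) + 8·10⁵L⁴θ²ℓ⁻²Σ‖Y‖²)·Lˡ`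
(the first conjunct of ✓ `levelMass_induction`, squared by `ρ²L = 1`, in numerals).
[cite: Balaban1985Averaging, Prop. 3 (122)-(126) p.36; Balaban1984PropagatorsI, (1.18)-(1.20) pp.19-20; Balaban1985BackgroundPropagators, Thm 3.11 p.416; Balaban1985Variational, (14)-(15) p.280, Prop. 7 p.299] -/
theorem sum_normSq_levelRatio_le_explicit_T3 (F : T3Family) (n K : ℕ)
    (U₀ W : GaugeField (F.P K) 0 (Matrix.specialUnitaryGroup (Fin 2) ℂ)) {ε : ℝ} (hε : 0 < ε) (hεL : 1000000 * (F.L : ℝ) ^ 5 * ε ≤ 1)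
    (hU : ∀ p : Plaq (F.P K) 0, dist1 (GaugeField.plaqHol U₀ p) ≤ ε * (((F.L : ℝ) ^ (K - n)) ^ 2)⁻¹)
    (Q : (k : ℕ) → (PBond (F.P K) 0 → Matrix (Fin 2) (Fin 2) ℂ) → PBond (F.P K) k → Matrix (Fin 2) (Fin 2) ℂ) (hQ0 : ∀ Y, Q 0 Y = Y)
    (hQs : ∀ (k : ℕ) (Y : PBond (F.P K) 0 → Matrix (Fin 2) (Fin 2) ℂ) (c : PBond (F.P K) (k + 1)), Q (k + 1) Y c
      = (fderiv ℂ (eml : (Idx (F.P K) → Matrix (Fin 2) (Fin 2) ℂ) → Matrix (Fin 2) (Fin 2) ℂ)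
            (fun i => ((loopHol (Averaging.iter (fun i => blockAvg (P := (F.P K)) (j := i) (expMeanLogSU (n := Fin 2))) k U₀) c i : Matrix.specialUnitaryGroup (Fin 2) ℂ) : Matrix (Fin 2) (Fin 2) ℂ))
            (fun i => covWalkSum (Averaging.iter (fun i => blockAvg (P := (F.P K)) (j := i) (expMeanLogSU (n := Fin 2))) k U₀) (Q k Y) (walk (emb c.src) (loopWord (F.P K).L c.dir (off i.1) i.2.1 i.2.2))
              * ((loopHol (Averaging.iter (fun i => blockAvg (P := (F.P K)) (j := i) (expMeanLogSU (n := Fin 2))) k U₀) c i : Matrix.specialUnitaryGroup (Fin 2) ℂ) : Matrix (Fin 2) (Fin 2) ℂ))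
            * star ((corr (expMeanLogSU (n := Fin 2)) (Averaging.iter (fun i => blockAvg (P := (F.P K)) (j := i) (expMeanLogSU (n := Fin 2))) k U₀) c : Matrix.specialUnitaryGroup (Fin 2) ℂ) : Matrix (Fin 2) (Fin 2) ℂ)
          + ((corr (expMeanLogSU (n := Fin 2)) (Averaging.iter (fun i => blockAvg (P := (F.P K)) (j := i) (expMeanLogSU (n := Fin 2))) k U₀) c : Matrix.specialUnitaryGroup (Fin 2) ℂ) : Matrix (Fin 2) (Fin 2) ℂ)
            * covWalkSum (Averaging.iter (fun i => blockAvg (P := (F.P K)) (j := i) (expMeanLogSU (n := Fin 2))) k U₀) (Q k Y) (walk (emb c.src) (List.replicate (F.P K).L (c.dir, true)))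
            * star ((corr (expMeanLogSU (n := Fin 2)) (Averaging.iter (fun i => blockAvg (P := (F.P K)) (j := i) (expMeanLogSU (n := Fin 2))) k U₀) c : Matrix.specialUnitaryGroup (Fin 2) ℂ) : Matrix (Fin 2) (Fin 2) ℂ)))
    (G S : (k : ℕ) → PBond (F.P K) k → Matrix (Fin 2) (Fin 2) ℂ) (Λ : (k : ℕ) → Site (F.P K) k → Matrix (Fin 2) (Fin 2) ℂ)
    (hG0 : ∀ b, G 0 b = pertVar U₀ W b) (hS0 : ∀ b, S 0 b = pertVar U₀ W b) (hΛ0 : ∀ x, Λ 0 x = 0)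
    (hΛs : ∀ (k : ℕ) (z : Site (F.P K) (k + 1)), Λ (k + 1) z
      = (((Fintype.card (Idx (F.P K)) : ℂ))⁻¹ • ∑ i : Idx (F.P K),
              covWalkSum (Averaging.iter (fun i => blockAvg (P := (F.P K)) (j := i) (expMeanLogSU (n := Fin 2))) k U₀) (G k) (walk (emb z) (stairWord i.2.1 (off i.1))))
        + Λ k (emb z))
    (hGs : ∀ (k : ℕ) (c : PBond (F.P K) (k + 1)), G (k + 1) c
      = (fderiv ℂ (eml : (Idx (F.P K) → Matrix (Fin 2) (Fin 2) ℂ) → Matrix (Fin 2) (Fin 2) ℂ)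
            (fun i => ((loopHol (Averaging.iter (fun i => blockAvg (P := (F.P K)) (j := i) (expMeanLogSU (n := Fin 2))) k U₀) c i : Matrix.specialUnitaryGroup (Fin 2) ℂ) : Matrix (Fin 2) (Fin 2) ℂ))
            (fun i => covWalkSum (Averaging.iter (fun i => blockAvg (P := (F.P K)) (j := i) (expMeanLogSU (n := Fin 2))) k U₀) (G k) (walk (emb c.src) (loopWord (F.P K).L c.dir (off i.1) i.2.1 i.2.2))
              * ((loopHol (Averaging.iter (fun i => blockAvg (P := (F.P K)) (j := i) (expMeanLogSU (n := Fin 2))) k U₀) c i : Matrix.specialUnitaryGroup (Fin 2) ℂ) : Matrix (Fin 2) (Fin 2) ℂ))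
            * star ((corr (expMeanLogSU (n := Fin 2)) (Averaging.iter (fun i => blockAvg (P := (F.P K)) (j := i) (expMeanLogSU (n := Fin 2))) k U₀) c : Matrix.specialUnitaryGroup (Fin 2) ℂ) : Matrix (Fin 2) (Fin 2) ℂ)
          + ((corr (expMeanLogSU (n := Fin 2)) (Averaging.iter (fun i => blockAvg (P := (F.P K)) (j := i) (expMeanLogSU (n := Fin 2))) k U₀) c : Matrix.specialUnitaryGroup (Fin 2) ℂ) : Matrix (Fin 2) (Fin 2) ℂ)
            * covWalkSum (Averaging.iter (fun i => blockAvg (P := (F.P K)) (j := i) (expMeanLogSU (n := Fin 2))) k U₀) (G k) (walk (emb c.src) (List.replicate (F.P K).L (c.dir, true)))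
            * star ((corr (expMeanLogSU (n := Fin 2)) (Averaging.iter (fun i => blockAvg (P := (F.P K)) (j := i) (expMeanLogSU (n := Fin 2))) k U₀) c : Matrix.specialUnitaryGroup (Fin 2) ℂ) : Matrix (Fin 2) (Fin 2) ℂ))
        - ((((Fintype.card (Idx (F.P K)) : ℂ))⁻¹ • ∑ i : Idx (F.P K),
              covWalkSum (Averaging.iter (fun i => blockAvg (P := (F.P K)) (j := i) (expMeanLogSU (n := Fin 2))) k U₀) (G k) (walk (emb c.src) (stairWord i.2.1 (off i.1))))
            - ((Averaging.iter (fun i => blockAvg (P := (F.P K)) (j := i) (expMeanLogSU (n := Fin 2))) (k + 1) U₀ c : Matrix.specialUnitaryGroup (Fin 2) ℂ) : Matrix (Fin 2) (Fin 2) ℂ)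
              * (((Fintype.card (Idx (F.P K)) : ℂ))⁻¹ • ∑ i : Idx (F.P K),
              covWalkSum (Averaging.iter (fun i => blockAvg (P := (F.P K)) (j := i) (expMeanLogSU (n := Fin 2))) k U₀) (G k) (walk (emb c.tgt) (stairWord i.2.1 (off i.1))))
              * star ((Averaging.iter (fun i => blockAvg (P := (F.P K)) (j := i) (expMeanLogSU (n := Fin 2))) (k + 1) U₀ c : Matrix.specialUnitaryGroup (Fin 2) ℂ) : Matrix (Fin 2) (Fin 2) ℂ)))
    (hSs : ∀ (k : ℕ) (c : PBond (F.P K) (k + 1)), S (k + 1) c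
      = ((Fintype.card (Idx (F.P K)) : ℂ))⁻¹ • ∑ i : Idx (F.P K),
          ((holAt (Averaging.iter (fun i => blockAvg (P := (F.P K)) (j := i) (expMeanLogSU (n := Fin 2))) k U₀) (walk (emb c.src) (stairWord i.2.1 (off i.1))) : Matrix.specialUnitaryGroup (Fin 2) ℂ) : Matrix (Fin 2) (Fin 2) ℂ) *
            covWalkSum (Averaging.iter (fun i => blockAvg (P := (F.P K)) (j := i) (expMeanLogSU (n := Fin 2))) k U₀) (S k)
              (walk (walkEnd (emb c.src) (stairWord i.2.1 (off i.1))) (List.replicate (F.P K).L (c.dir, true))) *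
          star ((holAt (Averaging.iter (fun i => blockAvg (P := (F.P K)) (j := i) (expMeanLogSU (n := Fin 2))) k U₀) (walk (emb c.src) (stairWord i.2.1 (off i.1))) : Matrix.specialUnitaryGroup (Fin 2) ℂ) : Matrix (Fin 2) (Fin 2) ℂ))
    (μ : ℕ → ℝ) (hμ0 : ∀ j < K - n, 0 ≤ μ j)
    (hμ : ∀ j < K - n, ∀ c : PBond (F.P K) (j + 1), ((((F.P K).d + 2) * (F.P K).L : ℕ) : ℝ) * ∑ b ∈ (univ.filter (fun b : PBond (F.P K) j => blockOf b.src = c.src ∨ blockOf b.src = c.tgt)), ‖(pertVar (Averaging.iter (fun i => blockAvg (P := (F.P K)) (j := i) (expMeanLogSU (n := Fin 2))) j U₀) (Averaging.iter (fun i => blockAvg (P := (F.P K)) (j := i) (expMeanLogSU (n := Fin 2))) j W)) b‖ ≤ μ j)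
    (hμ72 : ∀ j < K - n, 72 * μ j ≤ 1) (hμN : ∀ j < K - n, 3 * μ j + 1 / 24 < deltaSU (Fin 2))
    {θ : ℝ} (hθ0 : 0 ≤ θ) (hμθ : ∀ j < K - n, 7800 * (F.L : ℝ) ^ 3 * (F.L : ℝ) ^ (K - n) * μ j ≤ θ * (F.L : ℝ) ^ j)
    (hθL : 1000 * θ * (F.L : ℝ) ≤ 1) :
    ∀ l ≤ K - n, ∑ b : PBond (F.P K) l, ‖(pertVar (Averaging.iter (fun i => blockAvg (P := (F.P K)) (j := i) (expMeanLogSU (n := Fin 2))) l U₀) (Averaging.iter (fun i => blockAvg (P := (F.P K)) (j := i) (expMeanLogSU (n := Fin 2))) l W)) b‖ ^ 2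
      ≤ 7 * (∑ b : PBond (F.P K) 0, ‖pertVar U₀ W b‖ ^ 2) * ((F.L : ℝ) ^ l)⁻¹
        + (144 * (200 * (F.L : ℝ) ^ 4 * ((∑ x : Site (F.P K) 0, ∑ μ : Fin (F.P K).d, ∑ ν : Fin (F.P K).d,
            (if μ < ν then ∑ j : Fin 2, ∑ k : Fin 2,
              ‖(curl (torusT (F.P K) 0) (fun κ z => unitsField (toUField U₀) ⟨z, κ⟩) (fun κ z => pertVar U₀ W ⟨z, κ⟩) μ ν x) j k‖ ^ 2 else 0)) + (∑ x : Site (F.P K) 0, ∑ j : Fin 2, ∑ k : Fin 2,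
            ‖(divB (torusT (F.P K) 0) (fun κ z => unitsField (toUField U₀) ⟨z, κ⟩) (fun κ z => pertVar U₀ W ⟨z, κ⟩) x) j k‖ ^ 2)) + 4 * 10 ^ 9 * (F.L : ℝ) ^ 9 * ε * (((F.L : ℝ) ^ (K - n)) ^ 2)⁻¹ * (∑ b : PBond (F.P K) 0, ‖pertVar U₀ W b‖ ^ 2))
            + 800000 * (F.L : ℝ) ^ 4 * θ ^ 2 * (((F.L : ℝ) ^ (K - n)) ^ 2)⁻¹ * (∑ b : PBond (F.P K) 0, ‖pertVar U₀ W b‖ ^ 2)) * (F.L : ℝ) ^ l := by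
  -- T³ letters and the tower sizes (as in ✓ `…CurvedLandauCoreFibreT3`)
  have hL3 := three_le_L F
  have hLpos : (0 : ℝ) < (F.L : ℝ) := by linarith only [hL3]
  have hLF : (F.P K).L = F.L := rfl
  have hk : K - n ≤ (F.P K).m + (F.P K).K := by show K - n ≤ F.m + K; omega
  obtain ⟨-, hε3, hε2, hε24, -⟩ := smallness_T3 F K hε hεL
  have hε' : 0 < 2 * ε := by linarith only [hε]
  have hU' : PlaqSmall (2 * ε * ((((F.P K).L : ℝ) ^ (K - n))⁻¹) ^ 2) U₀ := by
    refine plaqSmall_of_le_of_lt hU ?_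
    rw [hLF, inv_pow]
    exact mul_lt_mul_of_pos_right (by linarith only [hε]) (inv_pos.mpr (by positivity))
  have hα := loop_size_geom (N := 2) (K - n) hε' hε3 hε2 hU'
  obtain ⟨hale, h24, hN⟩ := size_numerals (N := 2) (K - n) hε' hε2 hε24
  have ha0 : ∀ j : ℕ, (0 : ℝ) ≤ (((((F.P K).d + 2) * (F.P K).L : ℕ) : ℝ) ^ 2 / 2 * (2 * ε) * ((((F.P K).L : ℝ)) ^ (2 * j) / (((F.P K).L : ℝ)) ^ (2 * (K - n)))) := fun j => by positivity
  have ha'0 : (0 : ℝ) ≤ 2 * (2 * ε) := by positivity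
  have hV : ∀ j < K - n, ∀ q : Plaq (F.P K) j,
      dist1 (GaugeField.plaqHol (Averaging.iter (fun i => blockAvg (P := (F.P K)) (j := i) (expMeanLogSU (n := Fin 2))) j U₀) q) ≤ 2 * (2 * ε) :=
    fun j hj q => ((tower_plaq_lt (K - n) hε' hε3 hε2 hU' hj.le q).2).le
  obtain ⟨hρ0, hρ1, -, hρ2L⟩ := rho_facts F K
  obtain ⟨hD0, hD12, -⟩ := two_sqrt_d_facts F K
  -- the level rows (✓ `Prop7FibreLevelMass.sqrt_sum_normSq_levelRatio_le` at every level `l ≤ K − n`)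
  have hrec : ∀ l ≤ K - n, Real.sqrt (∑ b : PBond (F.P K) l, ‖(pertVar (Averaging.iter (fun i => blockAvg (P := (F.P K)) (j := i) (expMeanLogSU (n := Fin 2))) l U₀) (Averaging.iter (fun i => blockAvg (P := (F.P K)) (j := i) (expMeanLogSU (n := Fin 2))) l W)) b‖ ^ 2)
      ≤ Real.sqrt (((((F.P K).L : ℝ)) ^ (F.P K).d)⁻¹ * (((F.P K).L : ℝ)) ^ 2) ^ l * Real.exp ((159 * ((((F.P K).d + 2) * (F.P K).L : ℕ) : ℝ) * Real.sqrt (2 * (F.P K).d * (((F.P K).L : ℝ)) ^ (F.P K).d * (2 * (F.P K).d))) / Real.sqrt (((((F.P K).L : ℝ)) ^ (F.P K).d)⁻¹ * (((F.P K).L : ℝ)) ^ 2) * ∑ i ∈ Finset.range l, (((((F.P K).d + 2) * (F.P K).L : ℕ) : ℝ) ^ 2 / 2 * (2 * ε) * ((((F.P K).L : ℝ)) ^ (2 * i) / (((F.P K).L : ℝ)) ^ (2 * (K - n))))) * Real.sqrt (∑ b : PBond (F.P K) 0, ‖pertVar U₀ W b‖ ^ 2)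
        + 2 * Real.sqrt (F.P K).d * Real.sqrt (∑ y : Site (F.P K) l, ‖Λ l y‖ ^ 2)
        + (Real.exp ((159 * ((((F.P K).d + 2) * (F.P K).L : ℕ) : ℝ) * Real.sqrt (2 * (F.P K).d * (((F.P K).L : ℝ)) ^ (F.P K).d * (2 * (F.P K).d))) / Real.sqrt (((((F.P K).L : ℝ)) ^ (F.P K).d)⁻¹ * (((F.P K).L : ℝ)) ^ 2) * ∑ i ∈ Finset.range l, (((((F.P K).d + 2) * (F.P K).L : ℕ) : ℝ) ^ 2 / 2 * (2 * ε) * ((((F.P K).L : ℝ)) ^ (2 * i) / (((F.P K).L : ℝ)) ^ (2 * (K - n))))) * (∑ i ∈ Finset.range l, Real.sqrt (((((F.P K).L : ℝ)) ^ (F.P K).d)⁻¹ * (((F.P K).L : ℝ)) ^ 2) ^ (l - 1 - i) * (260 * (μ i * (((((F.P K).d + 2) * (F.P K).L : ℕ) : ℝ) * Real.sqrt (2 * (F.P K).d * (((F.P K).L : ℝ)) ^ (F.P K).d * (2 * (F.P K).d)) * Real.sqrt (∑ b : PBond (F.P K) i, ‖(pertVar (Averaging.iter (fun i => blockAvg (P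 := (F.P K)) (j := i) (expMeanLogSU (n := Fin 2))) i U₀) (Averaging.iter (fun i => blockAvg (P := (F.P K)) (j := i) (expMeanLogSU (n := Fin 2))) i W)) b‖ ^ 2)))))
        + 2 * Real.sqrt (F.P K).d * ∑ j ∈ Finset.range l, Real.sqrt (4 * (F.P K).d * ((((F.P K).d : ℝ) + 2) ^ 2 * (2 : ℕ) * (((F.P K).L : ℝ)) ^ 4) + (4 * (((F.P K).d : ℝ) + 2) ^ 2 * ((F.P K).d : ℝ) ^ 3 * (3 * (2 : ℕ) + 2 * (F.P K).d) * (((F.P K).L : ℝ)) ^ 6) * (2 * (2 * ε)) ^ 2) * (Real.exp ((159 * ((((F.P K).d + 2) * (F.P K).L : ℕ) : ℝ) * Real.sqrt (2 * (F.P K).d * (((F.P K).L : ℝ)) ^ (F.P K).d * (2 * (F.P K).d))) / Real.sqrt (((((F.P K).L : ℝ)) ^ (F.P K).d)⁻¹ * (((F.P K).L : ℝ)) ^ 2) * ∑ i ∈ Finset.range j, (((((F.P K).d + 2) * (F.P K).L : ℕ) : ℝ) ^ 2 / 2 * (2 * ε) * ((((F.P K).L : ℝ)) ^ (2 * i) /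 (((F.P K).L : ℝ)) ^ (2 * (K - n))))) * (∑ i ∈ Finset.range j, Real.sqrt (((((F.P K).L : ℝ)) ^ (F.P K).d)⁻¹ * (((F.P K).L : ℝ)) ^ 2) ^ (j - 1 - i) * (260 * (μ i * (((((F.P K).d + 2) * (F.P K).L : ℕ) : ℝ) * Real.sqrt (2 * (F.P K).d * (((F.P K).L : ℝ)) ^ (F.P K).d * (2 * (F.P K).d)) * Real.sqrt (∑ b : PBond (F.P K) i, ‖(pertVar (Averaging.iter (fun i => blockAvg (P := (F.P K)) (j := i) (expMeanLogSU (n := Fin 2))) i U₀) (Averaging.iter (fun i => blockAvg (P := (F.P K)) (j := i) (expMeanLogSU (n := Fin 2))) i W)) b‖ ^ 2))))))) := by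
    intro l hl
    exact sqrt_sum_normSq_levelRatio_le U₀ W (hl.trans hk) Q hQ0 hQs G S Λ hG0 hS0 hΛ0 hΛs hGs hSs (fun j => (((((F.P K).d + 2) * (F.P K).L : ℕ) : ℝ) ^ 2 / 2 * (2 * ε) * ((((F.P K).L : ℝ)) ^ (2 * j) / (((F.P K).L : ℝ)) ^ (2 * (K - n))))) ha0 ha'0
      (fun j hj => hα j (lt_of_lt_of_le hj hl)) (fun j hj => (hale j (lt_of_lt_of_le hj hl)).trans h24) (fun j hj => (hale j (lt_of_lt_of_le hj hl)).trans_lt hN)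
      (fun j hj => hV j (lt_of_lt_of_le hj hl)) μ (fun j hj => hμ0 j (lt_of_lt_of_le hj hl)) (fun j hj => hμ j (lt_of_lt_of_le hj hl))
      (fun j hj => hμ72 j (lt_of_lt_of_le hj hl)) (fun j hj => by linarith only [hμN j (lt_of_lt_of_le hj hl), (hale j (lt_of_lt_of_le hj hl)).trans h24])
  -- the scalar inputs of the induction
  have he : ∀ j ≤ K - n, 0 ≤ Real.exp ((159 * ((((F.P K).d + 2) * (F.P K).L : ℕ) : ℝ) * Real.sqrt (2 * (F.P K).d * (((F.P K).L : ℝ)) ^ (F.P K).d * (2 * (F.P K).d))) / Real.sqrt (((((F.P K).L : ℝ)) ^ (F.P K).d)⁻¹ * (((F.P K).L : ℝ)) ^ 2) * ∑ i ∈ Finset.range j, (((((F.P K).d + 2) * (F.P K).L : ℕ) : ℝ) ^ 2 / 2 * (2 * ε) * ((((F.P K).L : ℝ)) ^ (2 * i) / (((F.P K).L : ℝ)) ^ (2 * (K - n))))) ∧ Real.exp ((159 * ((((F.P K).d + 2) * (F.P K).L : ℕ) : ℝ) * Real.sqrt (2 * (F.P K).d * (((F.P K).L : ℝ)) ^ (F.P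 K).d * (2 * (F.P K).d))) / Real.sqrt (((((F.P K).L : ℝ)) ^ (F.P K).d)⁻¹ * (((F.P K).L : ℝ)) ^ 2) * ∑ i ∈ Finset.range j, (((((F.P K).d + 2) * (F.P K).L : ℕ) : ℝ) ^ 2 / 2 * (2 * ε) * ((((F.P K).L : ℝ)) ^ (2 * i) / (((F.P K).L : ℝ)) ^ (2 * (K - n))))) ≤ 3 / 2 :=
    fun j hj => ⟨(Real.exp_pos _).le, level_exp_le F n K hε hεL j hj⟩
  have hBsq0 : 0 ≤ (200 * (F.L : ℝ) ^ 4 * ((∑ x : Site (F.P K) 0, ∑ μ : Fin (F.P K).d, ∑ ν : Fin (F.P K).d,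
            (if μ < ν then ∑ j : Fin 2, ∑ k : Fin 2,
              ‖(curl (torusT (F.P K) 0) (fun κ z => unitsField (toUField U₀) ⟨z, κ⟩) (fun κ z => pertVar U₀ W ⟨z, κ⟩) μ ν x) j k‖ ^ 2 else 0)) + (∑ x : Site (F.P K) 0, ∑ j : Fin 2, ∑ k : Fin 2,
            ‖(divB (torusT (F.P K) 0) (fun κ z => unitsField (toUField U₀) ⟨z, κ⟩) (fun κ z => pertVar U₀ W ⟨z, κ⟩) x) j k‖ ^ 2)) + 4 * 10 ^ 9 * (F.L : ℝ) ^ 9 * ε * (((F.L : ℝ) ^ (K - n)) ^ 2)⁻¹ * (∑ b : PBond (F.P K) 0, ‖pertVar U₀ W b‖ ^ 2)) := by positivity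
  have hΛlev := sum_normSq_covIterLambda_le_level F n K U₀ hε hεL hU (pertVar U₀ W) G S Λ hΛ0 hG0 hS0 hΛs hGs hSs
  have hlam : ∀ l ≤ K - n, 0 ≤ Real.sqrt (∑ y : Site (F.P K) l, ‖Λ l y‖ ^ 2) ∧ Real.sqrt (((((F.P K).L : ℝ)) ^ (F.P K).d)⁻¹ * (((F.P K).L : ℝ)) ^ 2) ^ l * Real.sqrt (∑ y : Site (F.P K) l, ‖Λ l y‖ ^ 2) ≤ Real.sqrt (200 * (F.L : ℝ) ^ 4 * ((∑ x : Site (F.P K) 0, ∑ μ : Fin (F.P K).d, ∑ ν : Fin (F.P K).d,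
            (if μ < ν then ∑ j : Fin 2, ∑ k : Fin 2,
              ‖(curl (torusT (F.P K) 0) (fun κ z => unitsField (toUField U₀) ⟨z, κ⟩) (fun κ z => pertVar U₀ W ⟨z, κ⟩) μ ν x) j k‖ ^ 2 else 0)) + (∑ x : Site (F.P K) 0, ∑ j : Fin 2, ∑ k : Fin 2,
            ‖(divB (torusT (F.P K) 0) (fun κ z => unitsField (toUField U₀) ⟨z, κ⟩) (fun κ z => pertVar U₀ W ⟨z, κ⟩) x) j k‖ ^ 2)) + 4 * 10 ^ 9 * (F.L : ℝ) ^ 9 * ε * (((F.L : ℝ) ^ (K - n)) ^ 2)⁻¹ * (∑ b : PBond (F.P K) 0, ‖pertVar U₀ W b‖ ^ 2)) :=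
    fun l hl => ⟨Real.sqrt_nonneg _, rho_pow_mul_sqrt_le F K (Finset.sum_nonneg fun _ _ => sq_nonneg _) (hΛlev l hl)⟩
  have hC10 : 0 ≤ (((((F.P K).d + 2) * (F.P K).L : ℕ) : ℝ) * Real.sqrt (2 * (F.P K).d * (((F.P K).L : ℝ)) ^ (F.P K).d * (2 * (F.P K).d))) := by positivity
  have hμ' : ∀ l < K - n, 0 ≤ μ l ∧ 260 * (μ l * (((((F.P K).d + 2) * (F.P K).L : ℕ) : ℝ) * Real.sqrt (2 * (F.P K).d * (((F.P K).L : ℝ)) ^ (F.P K).d * (2 * (F.P K).d)))) ≤ θ * Real.sqrt (((((F.P K).L : ℝ)) ^ (F.P K).d)⁻¹ * (((F.P K).L : ℝ)) ^ 2) ^ (2 * ((K - n) - l)) :=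
    fun l hl => ⟨hμ0 l hl, coeff_of_B6 F n K hl.le (hμ0 l hl) (hμθ l hl)⟩
  have hsmall := theta_smallness F K hε hεL hθ0 hθL
  -- ★ the scalar induction
  obtain ⟨hlev, -⟩ := levelMass_induction hρ0 hρ1 hθ0 (by norm_num : (0 : ℝ) ≤ 3 / 2) (Real.sqrt_nonneg _ : 0 ≤ Real.sqrt (4 * (F.P K).d * ((((F.P K).d : ℝ) + 2) ^ 2 * (2 : ℕ) * (((F.P K).L : ℝ)) ^ 4) + (4 * (((F.P K).d : ℝ) + 2) ^ 2 * ((F.P K).d : ℝ) ^ 3 * (3 * (2 : ℕ) + 2 * (F.P K).d) * (((F.P K).L : ℝ)) ^ 6) * (2 * (2 * ε)) ^ 2)) hD0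
    (Real.sqrt_nonneg _ : 0 ≤ Real.sqrt (200 * (F.L : ℝ) ^ 4 * ((∑ x : Site (F.P K) 0, ∑ μ : Fin (F.P K).d, ∑ ν : Fin (F.P K).d,
            (if μ < ν then ∑ j : Fin 2, ∑ k : Fin 2,
              ‖(curl (torusT (F.P K) 0) (fun κ z => unitsField (toUField U₀) ⟨z, κ⟩) (fun κ z => pertVar U₀ W ⟨z, κ⟩) μ ν x) j k‖ ^ 2 else 0)) + (∑ x : Site (F.P K) 0, ∑ j : Fin 2, ∑ k : Fin 2,
            ‖(divB (torusT (F.P K) 0) (fun κ z => unitsField (toUField U₀) ⟨z, κ⟩) (fun κ z => pertVar U₀ W ⟨z, κ⟩) x) j k‖ ^ 2)) + 4 * 10 ^ 9 * (F.L : ℝ) ^ 9 * ε * (((F.L : ℝ) ^ (K - n)) ^ 2)⁻¹ * (∑ b : PBond (F.P K) 0, ‖pertVar U₀ W b‖ ^ 2))) hC10 (Real.sqrt_nonneg _ : 0 ≤ Real.sqrt (∑ b : PBond (F.P K) 0, ‖pertVar U₀ W b‖ ^ 2)) (K - n)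
    (fun l => Real.sqrt (∑ b : PBond (F.P K) l, ‖(pertVar (Averaging.iter (fun i => blockAvg (P := (F.P K)) (j := i) (expMeanLogSU (n := Fin 2))) l U₀) (Averaging.iter (fun i => blockAvg (P := (F.P K)) (j := i) (expMeanLogSU (n := Fin 2))) l W)) b‖ ^ 2)) (fun j => Real.exp ((159 * ((((F.P K).d + 2) * (F.P K).L : ℕ) : ℝ) * Real.sqrt (2 * (F.P K).d * (((F.P K).L : ℝ)) ^ (F.P K).d * (2 * (F.P K).d))) / Real.sqrt (((((F.P K).L : ℝ)) ^ (F.P K).d)⁻¹ * (((F.P K).L : ℝ)) ^ 2) * ∑ i ∈ Finset.range j, (((((F.P K).d + 2) * (F.P K).L : ℕ) : ℝ) ^ 2 / 2 * (2 * ε) * ((((F.P K).L : ℝ)) ^ (2 * i) / (((F.P K).L : ℝ)) ^ (2 * (K - n)))))) (fun l => Real.sqrt (∑ y : Site (F.P K) l, ‖Λ l y‖ ^ 2)) μ (fun j => (∑ i ∈ Finset.range j, Real.sqrt (((((F.P K).L : ℝ)) ^ (F.P K).d)⁻¹ * (((F.P K).L : ℝ)) ^ 2) ^ (j - 1 - i)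 * (260 * (μ i * (((((F.P K).d + 2) * (F.P K).L : ℕ) : ℝ) * Real.sqrt (2 * (F.P K).d * (((F.P K).L : ℝ)) ^ (F.P K).d * (2 * (F.P K).d)) * Real.sqrt (∑ b : PBond (F.P K) i, ‖(pertVar (Averaging.iter (fun i => blockAvg (P := (F.P K)) (j := i) (expMeanLogSU (n := Fin 2))) i U₀) (Averaging.iter (fun i => blockAvg (P := (F.P K)) (j := i) (expMeanLogSU (n := Fin 2))) i W)) b‖ ^ 2))))))
    (fun l => Real.sqrt_nonneg _) he hlam hμ' (fun j => rfl) hrec hsmall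
  -- ★ per level: `x_l² ≤ L^l·W_l²` (`ρ²L = 1`), then the numerals
  intro l hl
  have h1 := hlev l hl
  have h2 := sq_le_of_rho_pow_mul_le F K l (Real.sqrt_nonneg _ : 0 ≤ Real.sqrt (∑ b : PBond (F.P K) l, ‖(pertVar (Averaging.iter (fun i => blockAvg (P := (F.P K)) (j := i) (expMeanLogSU (n := Fin 2))) l U₀) (Averaging.iter (fun i => blockAvg (P := (F.P K)) (j := i) (expMeanLogSU (n := Fin 2))) l W)) b‖ ^ 2)) h1
  rw [Real.sq_sqrt (Finset.sum_nonneg fun _ _ => sq_nonneg _)] at h2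
  have hm0 : 0 ≤ (∑ b : PBond (F.P K) 0, ‖pertVar U₀ W b‖ ^ 2) := Finset.sum_nonneg fun _ _ => sq_nonneg _
  have hend := perLevel_endgame θ (Real.sqrt (∑ b : PBond (F.P K) 0, ‖pertVar U₀ W b‖ ^ 2)) l (K - n) hL3 hρ2L hD12 (K0_nonneg F K (ε := ε)) (K0_le F K hε hεL) hBsq0
  rw [Real.sq_sqrt hm0] at hend
  linarith only [h2, hend]

/-! ## §3 ★★ The same with `ε, θ` absorbed: L-only constants (the `hM` shape of ✓ `Prop7JointRowOfLevelMasses.jointRow_currency`) -/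

set_option maxHeartbeats 400000 in
/-- ★★ **THE PER-LEVEL `ℓ²` MASSES WITH L-ONLY CONSTANTS, FAMILIES DISCHARGED** (d = 3, `SU(2)`): under the binders of ✓ `sum_normSq_levelRatio_le_explicit_T3` minus the
recursion families (obtained inside from ✓ `exists_trueLinIter_family`, ✓ `exists_reduced_family`, ✓ `exists_pureLine_family`, ✓ `exists_coarseGauge_family`), for every `l ≤ K − n`,
`Σ_b‖Y_l(b)‖² ≤ 7·Σ‖Y‖²·(Lˡ)⁻¹ + (28800·L⁴·(Σ‖curl_{U₀}Y‖²_HS + Σ‖D^*_{U₀}Y‖²_HS) + 600000·L⁴·ℓ⁻²·Σ‖Y‖²)·Lˡ` (`10⁶L⁵ε ≤ 1`, `10³θL ≤ 1` absorb `ε` and `θ²`) —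
`M_l ≤ c_A·M₀·(Lˡ)⁻¹ + (c_B·KD + c_B′·(L^k)⁻²·M₀)·Lˡ` with `c_A = 7`, `c_B = 28800L⁴`, `c_B′ = 600000L⁴`.
[cite: Balaban1985Averaging, Prop. 3 (122)-(126) p.36; Balaban1984PropagatorsI, (1.18)-(1.20) pp.19-20; Balaban1985BackgroundPropagators, Thm 3.11 p.416; Balaban1985Variational, (14)-(15) p.280, Prop. 7 p.299] -/
theorem sum_normSq_levelRatio_le_LOnly_T3 (F : T3Family) (n K : ℕ)
    (U₀ W : GaugeField (F.P K) 0 (Matrix.specialUnitaryGroup (Fin 2) ℂ)) {ε : ℝ} (hε : 0 < ε) (hεL : 1000000 * (F.L : ℝ) ^ 5 * ε ≤ 1)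
    (hU : ∀ p : Plaq (F.P K) 0, dist1 (GaugeField.plaqHol U₀ p) ≤ ε * (((F.L : ℝ) ^ (K - n)) ^ 2)⁻¹)
    (μ : ℕ → ℝ) (hμ0 : ∀ j < K - n, 0 ≤ μ j)
    (hμ : ∀ j < K - n, ∀ c : PBond (F.P K) (j + 1), ((((F.P K).d + 2) * (F.P K).L : ℕ) : ℝ) * ∑ b ∈ (univ.filter (fun b : PBond (F.P K) j => blockOf b.src = c.src ∨ blockOf b.src = c.tgt)), ‖(pertVar (Averaging.iter (fun i => blockAvg (P := (F.P K)) (j := i) (expMeanLogSU (n := Fin 2))) j U₀) (Averaging.iter (fun i => blockAvg (P := (F.P K)) (j := i) (expMeanLogSU (n := Fin 2))) j W)) b‖ ≤ μ j)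
    (hμ72 : ∀ j < K - n, 72 * μ j ≤ 1) (hμN : ∀ j < K - n, 3 * μ j + 1 / 24 < deltaSU (Fin 2))
    {θ : ℝ} (hθ0 : 0 ≤ θ) (hμθ : ∀ j < K - n, 7800 * (F.L : ℝ) ^ 3 * (F.L : ℝ) ^ (K - n) * μ j ≤ θ * (F.L : ℝ) ^ j)
    (hθL : 1000 * θ * (F.L : ℝ) ≤ 1) :
    ∀ l ≤ K - n, ∑ b : PBond (F.P K) l, ‖(pertVar (Averaging.iter (fun i => blockAvg (P := (F.P K)) (j := i) (expMeanLogSU (n := Fin 2))) l U₀) (Averaging.iter (fun i => blockAvg (P := (F.P K)) (j := i) (expMeanLogSU (n := Fin 2))) l W)) b‖ ^ 2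
      ≤ 7 * (∑ b : PBond (F.P K) 0, ‖pertVar U₀ W b‖ ^ 2) * ((F.L : ℝ) ^ l)⁻¹
        + (28800 * (F.L : ℝ) ^ 4 * ((∑ x : Site (F.P K) 0, ∑ μ : Fin (F.P K).d, ∑ ν : Fin (F.P K).d,
            (if μ < ν then ∑ j : Fin 2, ∑ k : Fin 2,
              ‖(curl (torusT (F.P K) 0) (fun κ z => unitsField (toUField U₀) ⟨z, κ⟩) (fun κ z => pertVar U₀ W ⟨z, κ⟩) μ ν x) j k‖ ^ 2 else 0)) + (∑ x : Site (F.P K) 0, ∑ j : Fin 2, ∑ k : Fin 2,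
            ‖(divB (torusT (F.P K) 0) (fun κ z => unitsField (toUField U₀) ⟨z, κ⟩) (fun κ z => pertVar U₀ W ⟨z, κ⟩) x) j k‖ ^ 2))
            + 600000 * (F.L : ℝ) ^ 4 * (((F.L : ℝ) ^ (K - n)) ^ 2)⁻¹ * (∑ b : PBond (F.P K) 0, ‖pertVar U₀ W b‖ ^ 2)) * (F.L : ℝ) ^ l := by
  intro l hl
  -- the recursion families of record at `Y := pertVar U₀ W` (zero content)
  obtain ⟨Q, hQ0, hQs⟩ := exists_trueLinIter_family (N := 2) U₀
  obtain ⟨G, hG0, hGs⟩ := exists_reduced_family (N := 2) U₀ (pertVar U₀ W)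
  obtain ⟨S, hS0, hSs⟩ := exists_pureLine_family (n := 2) U₀ (pertVar U₀ W)
  obtain ⟨Λ, hΛ0, hΛs⟩ := exists_coarseGauge_family (N := 2) U₀ G
  have h := sum_normSq_levelRatio_le_explicit_T3 F n K U₀ W hε hεL hU Q hQ0 hQs G S Λ hG0 hS0 hΛ0 hΛs hGs hSs μ hμ0 hμ hμ72 hμN hθ0 hμθ hθL l hl
  have hL3 := three_le_L F
  have hL0 : (0 : ℝ) < (F.L : ℝ) := by linarith only [hL3]
  have hKD0 : 0 ≤ ((∑ x : Site (F.P K) 0, ∑ μ : Fin (F.P K).d, ∑ ν : Fin (F.P K).d,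
            (if μ < ν then ∑ j : Fin 2, ∑ k : Fin 2,
              ‖(curl (torusT (F.P K) 0) (fun κ z => unitsField (toUField U₀) ⟨z, κ⟩) (fun κ z => pertVar U₀ W ⟨z, κ⟩) μ ν x) j k‖ ^ 2 else 0)) + (∑ x : Site (F.P K) 0, ∑ j : Fin 2, ∑ k : Fin 2,
            ‖(divB (torusT (F.P K) 0) (fun κ z => unitsField (toUField U₀) ⟨z, κ⟩) (fun κ z => pertVar U₀ W ⟨z, κ⟩) x) j k‖ ^ 2)) := by positivity
  have hm0 : 0 ≤ (∑ b : PBond (F.P K) 0, ‖pertVar U₀ W b‖ ^ 2) := Finset.sum_nonneg fun _ _ => sq_nonneg _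
  have hLl : 0 ≤ (F.L : ℝ) ^ l := pow_nonneg hL0.le l
  -- `ε` and `θ` absorbed: `144·4·10⁹·L⁹·ε ≤ 576000·L⁴` (`10⁶L⁵ε ≤ 1`) and `8·10⁵·L⁴·θ² ≤ L²` (`10³θL ≤ 1`, so `10⁶θ²L² ≤ 1`)
  have hεabs : 144 * (4 * 10 ^ 9 * (F.L : ℝ) ^ 9 * ε) ≤ 576000 * (F.L : ℝ) ^ 4 := by
    have hL4 : 0 ≤ (F.L : ℝ) ^ 4 := pow_nonneg hL0.le 4
    have := mul_le_mul_of_nonneg_left hεL hL4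
    have e : (F.L : ℝ) ^ 4 * (1000000 * (F.L : ℝ) ^ 5 * ε) = 1000000 * (F.L : ℝ) ^ 9 * ε := by ring
    rw [e, mul_one] at this
    linarith
  have hθabs : 800000 * (F.L : ℝ) ^ 4 * θ ^ 2 ≤ 24000 * (F.L : ℝ) ^ 4 := by
    have hθ1 : θ * (F.L : ℝ) ≤ 1 / 1000 := by linarith
    have hθ0' : 0 ≤ θ * (F.L : ℝ) := mul_nonneg hθ0 hL0.le
    have hsq : (θ * (F.L : ℝ)) ^ 2 ≤ (1 / 1000) ^ 2 := pow_le_pow_left₀ hθ0' hθ1 2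
    have hL2 : 0 ≤ (F.L : ℝ) ^ 2 := sq_nonneg _
    have h9 : (1 : ℝ) ≤ (F.L : ℝ) ^ 2 := by nlinarith
    nlinarith [mul_le_mul_of_nonneg_left hsq hL2]
  have hX0 : 0 ≤ (((F.L : ℝ) ^ (K - n)) ^ 2)⁻¹ * (∑ b : PBond (F.P K) 0, ‖pertVar U₀ W b‖ ^ 2) * (F.L : ℝ) ^ l := by positivity
  have key : (144 * (200 * (F.L : ℝ) ^ 4 * ((∑ x : Site (F.P K) 0, ∑ μ : Fin (F.P K).d, ∑ ν : Fin (F.P K).d,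
            (if μ < ν then ∑ j : Fin 2, ∑ k : Fin 2,
              ‖(curl (torusT (F.P K) 0) (fun κ z => unitsField (toUField U₀) ⟨z, κ⟩) (fun κ z => pertVar U₀ W ⟨z, κ⟩) μ ν x) j k‖ ^ 2 else 0)) + (∑ x : Site (F.P K) 0, ∑ j : Fin 2, ∑ k : Fin 2,
            ‖(divB (torusT (F.P K) 0) (fun κ z => unitsField (toUField U₀) ⟨z, κ⟩) (fun κ z => pertVar U₀ W ⟨z, κ⟩) x) j k‖ ^ 2)) + 4 * 10 ^ 9 * (F.L : ℝ) ^ 9 * ε * (((F.L : ℝ) ^ (K - n)) ^ 2)⁻¹ * (∑ b : PBond (F.P K) 0, ‖pertVar U₀ W b‖ ^ 2))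
            + 800000 * (F.L : ℝ) ^ 4 * θ ^ 2 * (((F.L : ℝ) ^ (K - n)) ^ 2)⁻¹ * (∑ b : PBond (F.P K) 0, ‖pertVar U₀ W b‖ ^ 2)) * (F.L : ℝ) ^ l
      ≤ (28800 * (F.L : ℝ) ^ 4 * ((∑ x : Site (F.P K) 0, ∑ μ : Fin (F.P K).d, ∑ ν : Fin (F.P K).d,
            (if μ < ν then ∑ j : Fin 2, ∑ k : Fin 2,
              ‖(curl (torusT (F.P K) 0) (fun κ z => unitsField (toUField U₀) ⟨z, κ⟩) (fun κ z => pertVar U₀ W ⟨z, κ⟩) μ ν x) j k‖ ^ 2 else 0)) + (∑ x : Site (F.P K) 0, ∑ j : Fin 2, ∑ k : Fin 2,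
            ‖(divB (torusT (F.P K) 0) (fun κ z => unitsField (toUField U₀) ⟨z, κ⟩) (fun κ z => pertVar U₀ W ⟨z, κ⟩) x) j k‖ ^ 2))
            + 600000 * (F.L : ℝ) ^ 4 * (((F.L : ℝ) ^ (K - n)) ^ 2)⁻¹ * (∑ b : PBond (F.P K) 0, ‖pertVar U₀ W b‖ ^ 2)) * (F.L : ℝ) ^ l := by
    have e1 : (144 * (200 * (F.L : ℝ) ^ 4 * ((∑ x : Site (F.P K) 0, ∑ μ : Fin (F.P K).d, ∑ ν : Fin (F.P K).d,
            (if μ < ν then ∑ j : Fin 2, ∑ k : Fin 2,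
              ‖(curl (torusT (F.P K) 0) (fun κ z => unitsField (toUField U₀) ⟨z, κ⟩) (fun κ z => pertVar U₀ W ⟨z, κ⟩) μ ν x) j k‖ ^ 2 else 0)) + (∑ x : Site (F.P K) 0, ∑ j : Fin 2, ∑ k : Fin 2,
            ‖(divB (torusT (F.P K) 0) (fun κ z => unitsField (toUField U₀) ⟨z, κ⟩) (fun κ z => pertVar U₀ W ⟨z, κ⟩) x) j k‖ ^ 2)) + 4 * 10 ^ 9 * (F.L : ℝ) ^ 9 * ε * (((F.L : ℝ) ^ (K - n)) ^ 2)⁻¹ * (∑ b : PBond (F.P K) 0, ‖pertVar U₀ W b‖ ^ 2))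
            + 800000 * (F.L : ℝ) ^ 4 * θ ^ 2 * (((F.L : ℝ) ^ (K - n)) ^ 2)⁻¹ * (∑ b : PBond (F.P K) 0, ‖pertVar U₀ W b‖ ^ 2)) * (F.L : ℝ) ^ l
        = 28800 * (F.L : ℝ) ^ 4 * ((∑ x : Site (F.P K) 0, ∑ μ : Fin (F.P K).d, ∑ ν : Fin (F.P K).d,
            (if μ < ν then ∑ j : Fin 2, ∑ k : Fin 2,
              ‖(curl (torusT (F.P K) 0) (fun κ z => unitsField (toUField U₀) ⟨z, κ⟩) (fun κ z => pertVar U₀ W ⟨z, κ⟩) μ ν x) j k‖ ^ 2 else 0)) + (∑ x : Site (F.P K) 0, ∑ j : Fin 2, ∑ k : Fin 2,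
            ‖(divB (torusT (F.P K) 0) (fun κ z => unitsField (toUField U₀) ⟨z, κ⟩) (fun κ z => pertVar U₀ W ⟨z, κ⟩) x) j k‖ ^ 2)) * (F.L : ℝ) ^ l
          + (144 * (4 * 10 ^ 9 * (F.L : ℝ) ^ 9 * ε) + 800000 * (F.L : ℝ) ^ 4 * θ ^ 2) * ((((F.L : ℝ) ^ (K - n)) ^ 2)⁻¹ * (∑ b : PBond (F.P K) 0, ‖pertVar U₀ W b‖ ^ 2) * (F.L : ℝ) ^ l) := by ring
    have e2 : (28800 * (F.L : ℝ) ^ 4 * ((∑ x : Site (F.P K) 0, ∑ μ : Fin (F.P K).d, ∑ ν : Fin (F.P K).d,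
            (if μ < ν then ∑ j : Fin 2, ∑ k : Fin 2,
              ‖(curl (torusT (F.P K) 0) (fun κ z => unitsField (toUField U₀) ⟨z, κ⟩) (fun κ z => pertVar U₀ W ⟨z, κ⟩) μ ν x) j k‖ ^ 2 else 0)) + (∑ x : Site (F.P K) 0, ∑ j : Fin 2, ∑ k : Fin 2,
            ‖(divB (torusT (F.P K) 0) (fun κ z => unitsField (toUField U₀) ⟨z, κ⟩) (fun κ z => pertVar U₀ W ⟨z, κ⟩) x) j k‖ ^ 2))
            + 600000 * (F.L : ℝ) ^ 4 * (((F.L : ℝ) ^ (K - n)) ^ 2)⁻¹ * (∑ b : PBond (F.P K) 0, ‖pertVar U₀ W b‖ ^ 2)) * (F.L : ℝ) ^ l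
        = 28800 * (F.L : ℝ) ^ 4 * ((∑ x : Site (F.P K) 0, ∑ μ : Fin (F.P K).d, ∑ ν : Fin (F.P K).d,
            (if μ < ν then ∑ j : Fin 2, ∑ k : Fin 2,
              ‖(curl (torusT (F.P K) 0) (fun κ z => unitsField (toUField U₀) ⟨z, κ⟩) (fun κ z => pertVar U₀ W ⟨z, κ⟩) μ ν x) j k‖ ^ 2 else 0)) + (∑ x : Site (F.P K) 0, ∑ j : Fin 2, ∑ k : Fin 2,
            ‖(divB (torusT (F.P K) 0) (fun κ z => unitsField (toUField U₀) ⟨z, κ⟩) (fun κ z => pertVar U₀ W ⟨z, κ⟩) x) j k‖ ^ 2)) * (F.L : ℝ) ^ l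
          + (600000 * (F.L : ℝ) ^ 4) * ((((F.L : ℝ) ^ (K - n)) ^ 2)⁻¹ * (∑ b : PBond (F.P K) 0, ‖pertVar U₀ W b‖ ^ 2) * (F.L : ℝ) ^ l) := by ring
    rw [e1, e2]
    have hc : 144 * (4 * 10 ^ 9 * (F.L : ℝ) ^ 9 * ε) + 800000 * (F.L : ℝ) ^ 4 * θ ^ 2 ≤ 600000 * (F.L : ℝ) ^ 4 := by linarith
    have := mul_le_mul_of_nonneg_right hc hX0
    linarith
  linarith only [h, key]

end Summit.QuantumFields.YangMills.Theorems.Prop7FibreLevelMassPerLevelT3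

end
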